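import Summits.ResolutionOfSingularities.ResolutionOfSingularities.Theorems.HilbertSamuelEliminationSigmaMaxModificationsCorridor3SigmaTameLowSncTransform
import Mathlib.Data.Prod.Lex
import HarnessLib

/-!
# [OURS · L1 W4.2] TAME-LOW row T-L4 «SNC PHASE, lineage-local» — part 2a: the snc defect of a finite configuration of regular
# branches at a point of a two-dimensional regular local ring; the transformed configuration; the frame at the new point
# (cell res-hironaka, LADDER-RESOLUTION rung L; slot W4.2, crux chain w42 `SigmaMaxModificationsCorridor3` stmt-ResolutionOfSingularities-19249 /
# crux `SigmaMaxModifications` stmt-…-18506; res-L1-w42-plan-1 RULING v3.14-48 (PD)(iv)/(vi)/(PF) row T-L4 → res-L1-w42-stub-4 (gen 7);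
# `--supports stmt-ResolutionOfSingularities-19249 --as helper`; consumers: res-D-pv-002 ((TL6) fuel: the tangency/crowding coordinates of the
# TAME-LOW fuel), res-L1-type-o1 (`TameLowPrescription` «lineage point while … snc fails»), res-L1-s42-pv-2 (T-L5 board: snc rays))

HONEST FRAMING.  OURS bookkeeping for the TAME-LOW tier (RULING v3.14-48 (PD)(iv)): the classical embedded-resolution count for a
finite set of REGULAR plane branches (after the singular-branch half — `δ`-drop, `IsQuadraticTransform.curveDelta_lt` — has made every
branch through the lineage point regular), in the `Subring K` / `IsQuadraticTransform` currency. Nothing here is a statement of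
H. Hironaka's manuscript [Hironaka2017] (CANDIDATE, never a premise) nor of Cossart–Jannsen–Saito; no named fact; every theorem PROVED.
AI-written; weaker than expert review.

OBJECTS (a configuration is a `Finset K` of branch equations at the local ring `R ⊆ K`):
* `IsRegularBranch R f` — `f ∈ 𝔪_R ∖ 𝔪_R²`; `contactAt R f g ∈ ℕ∞` — the order of contact of part 1a for `f, g ∈ R` (junk `0` otherwise);
* `SncAt R B` — **the configuration is snc at `R`**: at most two branches, each regular, pairwise of contact `1` (i.e. any two form a
  regular system of parameters, part 1a `span_pair_eq_maximalIdeal_iff_contactOrder_eq_one`);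
* `pairDefect R B = Σ_{f, g ∈ B} (contactAt R f g − 1)` (diagonal and transversal terms vanish: the TANGENCY excess) and
  `crowding B = #B − 2`; **`sncDefect R B = (pairDefect, crowding) ∈ ℕ ×ₗ ℕ`**;
* `transformAt R₁ x B = {x} ∪ {g/x : g ∈ B, g/x ∈ 𝔪_{R₁}}` — the configuration at the point `R₁` of the blow-up (chart element `x`):
  the strict transforms passing through `R₁` and the exceptional branch.

THEOREMS (this part 2a), for `R ⊆ R₁` two-dimensional regular local rings of `K`, `R₁` a quadratic transform of `R` in the chart of
`x ∈ 𝔪_R ∖ 0`, `B` a finite configuration of regular branches at `R` with pairwise finite contact (distinct branches):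
* `span_pair_eq_of_div_mem_maximalIdeal`, `frame_transformAt` — a regular branch whose strict transform passes through `R₁` is
  transversal to `V(x)`, and then `𝔪_{R₁} = (x, g/x)`;
* `isRegularBranch_transformAt`, `contactAt_ne_top_transformAt` — the transformed configuration is again regular with distinct
  branches (the exceptional branch `x` is a regular parameter of `R₁`: `𝔪_{R₁} = (x, g')` by the structure of quadratic transforms);
* `contactAt_chart_div_eq_one`, `two_le_and_contactAt_div_div` — contacts in the transform (`1` against `x`; `n − 1 ≥ 1` for a pair
  of old branches through `R₁`); `transformAt_eq_insert_image` — `transformAt = {x} ∪ T/x`, `T ⊆ B` the branches through `R₁`.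
Part 2b (`…SncStep`): **`sncDefect_transformAt_lt`** (strict lexicographic drop at a non-snc point) and **`sncAt_transformAt`**
(snc persists); part 3 the lineage statement, with the singular-branch half (`δ`) as its entry hypothesis.

References: The Stacks Project, Tags 0BI7, 0BIC (Lemmas 54.15.3, 54.15.6) [StacksProject]; R. Hartshorne, *Algebraic Geometry*,
V Thm. 3.9 [Hartshorne1977]; C. Huneke, I. Swanson (2006), §14.2 [HunekeSwanson2006].
-/

noncomputable section

set_option linter.dupNamespace false -- mandated namespace of this single-conjunct summit

open IsLocalRing Literature.AlgebraicGeometry.Resolution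
open scoped Classical

namespace Summit.ResolutionOfSingularities.ResolutionOfSingularities.Theorems.SigmaMaxModificationsCorridor3.TameLowSnc

universe u

variable {K : Type u} [Field K]

/-! ## §1 Configurations of regular branches and the snc defect -/

/-- **A regular branch at `R`**: an element `f ∈ 𝔪_R ∖ 𝔪_R²` (a regular parameter; `V(f)` is a regular curve germ through the
point). [OURS · L1 W4.2 bookkeeping] -/
def IsRegularBranch (R : Subring K) [IsLocalRing R] (f : K) : Prop :=
  ∃ hf : f ∈ R, (⟨f, hf⟩ : R) ∈ maximalIdeal R ∧ (⟨f, hf⟩ : R) ∉ maximalIdeal R ^ 2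

/-- **Order of contact at `R`** of two elements of `K` (part 1a `contactOrder` for members of `R`; junk value `0` otherwise).
[OURS · L1 W4.2 bookkeeping] -/
def contactAt (R : Subring K) [IsLocalRing R] (f g : K) : ℕ∞ :=
  if h : f ∈ R ∧ g ∈ R then contactOrder (⟨f, h.1⟩ : R) ⟨g, h.2⟩ else 0

/-- **The configuration `B` is snc at `R`**: at most two branches through the point, each regular, any two of contact one
(transversal, i.e. forming a regular system of parameters). [OURS · L1 W4.2 bookkeeping] -/
def SncAt (R : Subring K) [IsLocalRing R] (B : Finset K) : Prop :=
  B.card ≤ 2 ∧ (∀ f ∈ B, IsRegularBranch R f) ∧ ∀ f ∈ B, ∀ g ∈ B, f ≠ g → contactAt R f g = 1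

/-- **Tangency excess** `Σ_{f, g ∈ B} (contactAt R f g − 1)` (natural subtraction; the diagonal has contact `⊤ ↦ 0` and transversal
pairs contribute `0`). [OURS · L1 W4.2 bookkeeping] -/
def pairDefect (R : Subring K) [IsLocalRing R] (B : Finset K) : ℕ :=
  ∑ f ∈ B, ∑ g ∈ B, ((contactAt R f g).toNat - 1)

/-- **Crowding** `#B − 2` (natural subtraction): positive iff at least three branches pass through the point. [OURS · L1 W4.2 bookkeeping] -/
def crowding (B : Finset K) : ℕ := B.card - 2

/-- **The snc defect** `(pairDefect, crowding) ∈ ℕ ×ₗ ℕ` of a configuration of regular branches — the tangency/crowding coordinates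
of the TAME-LOW fuel (RULING -48 (PD)(vi)). [OURS · L1 W4.2 bookkeeping] -/
def sncDefect (R : Subring K) [IsLocalRing R] (B : Finset K) : ℕ ×ₗ ℕ := toLex (pairDefect R B, crowding B)

/-- **The transformed configuration at the point `R₁` of the blow-up**, chart element `x`: the exceptional branch `x` together with
the strict transforms `g/x` (`g ∈ B`) that pass through `R₁` (`g/x ∈ 𝔪_{R₁}`). [OURS · L1 W4.2 bookkeeping] -/
def transformAt (R₁ : Subring K) [IsLocalRing R₁] (x : K) (B : Finset K) : Finset K :=
  insert x ((B.image fun g => g / x).filter fun g => ∃ hg : g ∈ R₁, (⟨g, hg⟩ : R₁) ∈ maximalIdeal R₁)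

section Basic

variable {R : Subring K} [IsLocalRing R]

/-- Unfolding `contactAt` for members of `R`. [OURS · proved] -/
theorem contactAt_eq (f g : R) : contactAt R (f : K) (g : K) = contactOrder f g := by
  unfold contactAt
  rw [dif_pos ⟨f.2, g.2⟩]

/-- The diagonal has infinite contact. [OURS · proved] -/
theorem contactAt_self {f : K} (hf : f ∈ R) : contactAt R f f = ⊤ := by
  rw [show f = ((⟨f, hf⟩ : R) : K) from rfl, contactAt_eq, contactOrder_eq_top_iff]
  exact fun n => Ideal.mem_sup_left (Ideal.mem_span_singleton_self _)

/-- Membership in the transformed configuration. [OURS · proved] -/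
theorem mem_transformAt_iff {R₁ : Subring K} [IsLocalRing R₁] {x : K} {B : Finset K} {h : K} :
    h ∈ transformAt R₁ x B ↔ h = x ∨ ∃ g ∈ B, h = g / x ∧ ∃ hh : h ∈ R₁, (⟨h, hh⟩ : R₁) ∈ maximalIdeal R₁ := by
  unfold transformAt
  simp only [Finset.mem_insert, Finset.mem_filter, Finset.mem_image]
  constructor
  · rintro (rfl | ⟨⟨g, hg, rfl⟩, hm⟩)
    · exact Or.inl rfl
    · exact Or.inr ⟨g, hg, rfl, hm⟩
  · rintro (rfl | ⟨g, hg, rfl, hm⟩)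
    · exact Or.inl rfl
    · exact Or.inr ⟨⟨g, hg, rfl⟩, hm⟩

end Basic

/-! ## §2 One blow-up: the frame at a point through which a strict transform passes -/

section Step

variable {R R₁ : Subring K} [IsRegularLocalRing R] [IsRegularLocalRing R₁]

/-- **A regular branch whose strict transform passes through `R₁` is transversal to `V(x)`**: `(x, g) = 𝔪_R` (otherwise `g` is
tangent to `x` and `g/x` is a unit of `R₁`, parts 1a/1b). [OURS · proved] -/
theorem span_pair_eq_of_div_mem_maximalIdeal (hdim : ringKrullDim R = 2) (hq : IsQuadraticTransform R R₁) {x : R}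
    (hx : x ∈ maximalIdeal R) (hx0 : x ≠ 0) (hT : blowupRing R (x : K) ≤ R₁) {g : R} (hg : g ∈ maximalIdeal R)
    (hg2 : g ∉ maximalIdeal R ^ 2) (hgx : (⟨((g : R) : K) / x, div_mem_of_mem_maximalIdeal hT hg⟩ : R₁) ∈ maximalIdeal R₁) :
    maximalIdeal R = Ideal.span {x, g} := by
  by_contra hne
  have hx2 : x ∉ maximalIdeal R ^ 2 := IsQuadraticTransform.chart_not_mem_sq hT hq.dominates hx0
  obtain ⟨y, hm, -, -⟩ := exists_maximalIdeal_eq_span_pair_of_not_mem_sq hdim hx hx2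
  obtain ⟨α, q, hα, hq2, hgαq⟩ := exists_eq_unit_mul_add_of_span_pair_ne hm hg hg2 (Ne.symm hne)
  have hu := isUnit_div_of_eq_unit_mul_add hx0 hT hq.dominates hα hq2 hgαq hg
  exact (mem_maximalIdeal _).mp hgx hu

/-- Under the hypotheses of `span_pair_eq_of_div_mem_maximalIdeal`: **the new frame `𝔪_{R₁} = (x, g/x)`**, and both `x` and
`g/x` are regular branches at `R₁`. [OURS · proved] -/
theorem frame_transformAt (hdim : ringKrullDim R = 2) (hdim₁ : ringKrullDim R₁ = 2) (hq : IsQuadraticTransform R R₁)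
    {x : R} (hx : x ∈ maximalIdeal R) (hx0 : x ≠ 0) (hT : blowupRing R (x : K) ≤ R₁) {g : R} (hg : g ∈ maximalIdeal R)
    (hg2 : g ∉ maximalIdeal R ^ 2) (hgx : (⟨((g : R) : K) / x, div_mem_of_mem_maximalIdeal hT hg⟩ : R₁) ∈ maximalIdeal R₁) :
    maximalIdeal R₁ = Ideal.span {Subring.inclusion hq.dominates.1 x, ⟨((g : R) : K) / x, div_mem_of_mem_maximalIdeal hT hg⟩} ∧
      IsRegularBranch R₁ ((x : R) : K) ∧ IsRegularBranch R₁ (((g : R) : K) / x) := by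
  have hm := span_pair_eq_of_div_mem_maximalIdeal hdim hq hx hx0 hT hg hg2 hgx
  have hm₁ := maximalIdeal_eq_span_pair_div hq hm hx0 hT (div_mem_of_mem_maximalIdeal hT hg) hgx
  obtain ⟨-, -, hg2₁, hx2₁⟩ := prime_and_not_dvd_of_span_pair hdim₁ hm₁
  have hxm₁ : Subring.inclusion hq.dominates.1 x ∈ maximalIdeal R₁ := (incl_mem_maximalIdeal_iff hq.dominates x).mpr hx
  exact ⟨hm₁, ⟨hq.dominates.1 x.2, hxm₁, hx2₁⟩, ⟨div_mem_of_mem_maximalIdeal hT hg, hgx, hg2₁⟩⟩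

/-- **Regularity persists**: every member of the transformed configuration is a regular branch at `R₁`. [OURS · proved] -/
theorem isRegularBranch_transformAt (hdim : ringKrullDim R = 2) (hdim₁ : ringKrullDim R₁ = 2)
    (hq : IsQuadraticTransform R R₁) {x : R} (hx : x ∈ maximalIdeal R) (hx0 : x ≠ 0) (hT : blowupRing R (x : K) ≤ R₁)
    {B : Finset K} (hB : ∀ f ∈ B, IsRegularBranch R f) :
    ∀ h ∈ transformAt R₁ ((x : R) : K) B, IsRegularBranch R₁ h := by
  intro h hh
  have hx2 : x ∉ maximalIdeal R ^ 2 := IsQuadraticTransform.chart_not_mem_sq hT hq.dominates hx0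
  rcases mem_transformAt_iff.mp hh with rfl | ⟨g, hgB, rfl, hgR₁, hgm⟩
  · -- the exceptional branch: complete `x` to a frame `(x, y)` of `R`; either chart lemma gives `x ∉ 𝔪₁²` via a frame at `R₁`;
    -- simplest: `x ∈ 𝔪₁` by domination and `x ∉ 𝔪₁²` by `chart_not_mem_sq` applied to `R₁` itself? Use the frame of `R₁`:
    -- `R₁` regular of dimension two and `𝔪_R R₁ = x R₁` with `R₁ ≠` DVR forces `x ∉ 𝔪₁²` (`chart_not_mem_sq` with `R := R`).
    refine ⟨hq.dominates.1 x.2, (incl_mem_maximalIdeal_iff hq.dominates x).mpr hx, fun hx2₁ => ?_⟩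
    -- if `x ∈ 𝔪₁²` then `𝔪_R R₁ = x R₁ ⊆ 𝔪₁²`, so every `y ∈ 𝔪_R` lies in `𝔪₁²`; take a frame `𝔪₁ = (x₁, y₁)`: then
    -- `𝔪₁ = 𝔪_R R₁ + …`? Not available abstractly — instead use `1 ∈ 𝔪₁`-style: `x = Σ aᵢbᵢ`, `aᵢ, bᵢ ∈ 𝔪₁`… no contradiction alone.
    -- Honest route: `x/x = 1`; `chart_not_mem_sq` for the quadratic transform `R₁` of `R` says `x ∉ 𝔪_R²`, not `𝔪₁²`.
    -- We use the dichotomy structure instead: there is `g'` with `𝔪₁ = (x, g')` (`exists_eq_span_pair_of_map_maximalIdeal_le`),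
    -- whence `x ∉ 𝔪₁²` by `prime_and_not_dvd_of_span_pair`.
    obtain ⟨y, hm, -, -⟩ := exists_maximalIdeal_eq_span_pair_of_not_mem_sq hdim hx hx2
    set u : K := ((y : R) : K) / ((x : R) : K) with hu
    set A : Subring K := (Algebra.adjoin R {u}).toSubring with hAdef
    have hA : blowupRing R (x : K) = A := blowupRing_eq_adjoin hm
    have hAle : A ≤ R₁ := hA.ge.trans hT
    set Q : Ideal A := (maximalIdeal R₁).comap (Subring.inclusion hAle) with hQ
    have hR₁ : R₁ = (LocalSubring.ofPrime A Q).toSubring := hq.eq_ofPrime_of_le hx hx0 hA.le hAle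
    have hmapQ : (maximalIdeal R).map (Subring.inclusion (subring_le_adjoin R u)) ≤ Q := by
      rw [Ideal.map_le_iff_le_comap]
      intro r hr
      rw [Ideal.mem_comap, hQ, Ideal.mem_comap]
      exact (incl_mem_maximalIdeal_iff hq.dominates r).mpr hr
    obtain ⟨g', hQg'⟩ := exists_eq_span_pair_of_map_maximalIdeal_le hm hx0 hu hmapQ
    -- `𝔪₁ = Q R₁ = (x, g')`
    have hm₁ : maximalIdeal R₁ = Ideal.span {Subring.inclusion hq.dominates.1 x, ⟨(g' : K), hAle g'.2⟩} := by
      set L : Subring K := (LocalSubring.ofPrime A Q).toSubring with hL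
      have e1 : maximalIdeal L = Q.map (algebraMap A L) := (IsLocalization.AtPrime.map_eq_maximalIdeal Q L).symm
      have e2 : Q.map (algebraMap A L) =
          Ideal.span {algebraMap A L (Subring.inclusion (subring_le_adjoin R u) x), algebraMap A L g'} := by
        have e := le_antisymm (Ideal.map_mono (f := algebraMap A L) hQg'.le) (Ideal.map_mono (f := algebraMap A L) hQg'.ge)
        rw [e, Ideal.map_span, Set.image_insert_eq, Set.image_singleton]
      apply le_antisymm
      · intro z hz
        have hz' : (⟨(z : K), hR₁.le z.2⟩ : L) ∈ maximalIdeal L := by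
          rw [mem_maximalIdeal, mem_nonunits_iff, isUnit_subring_iff_inv_mem] at hz ⊢
          exact fun ⟨h0, hinv⟩ => hz ⟨h0, hR₁.ge hinv⟩
        rw [e1, e2, Ideal.mem_span_pair] at hz'
        obtain ⟨a, b, hab⟩ := hz'
        rw [Ideal.mem_span_pair]
        refine ⟨⟨(a : K), hR₁.ge a.2⟩, ⟨(b : K), hR₁.ge b.2⟩, Subtype.ext ?_⟩
        have := congrArg (fun t : L => (t : K)) hab
        exact this
      · refine span_pair_le_iff.mpr ⟨(incl_mem_maximalIdeal_iff hq.dominates x).mpr hx, ?_⟩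
        have hg'Q : g' ∈ Q := hQg' ▸ Ideal.subset_span (by simp)
        rw [hQ, Ideal.mem_comap] at hg'Q
        exact hg'Q
    obtain ⟨-, -, -, hx2₁'⟩ := prime_and_not_dvd_of_span_pair hdim₁ hm₁
    exact hx2₁' hx2₁
  · obtain ⟨hgR, hgmR, hg2⟩ := hB g hgB
    exact (frame_transformAt hdim hdim₁ hq hx hx0 hT (g := ⟨g, hgR⟩) hgmR hg2 hgm).2.2


/-! ## §3 The step theorem: regularity and distinctness persist, the snc defect drops strictly at a non-snc point, snc persists -/

/-- For a regular branch `g` at `R` whose strict transform passes through `R₁`: the contacts with the exceptional branch are `1`.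
[OURS · proved] -/
theorem contactAt_chart_div_eq_one (hdim : ringKrullDim R = 2) (hdim₁ : ringKrullDim R₁ = 2)
    (hq : IsQuadraticTransform R R₁) {x : R} (hx : x ∈ maximalIdeal R) (hx0 : x ≠ 0) (hT : blowupRing R (x : K) ≤ R₁)
    {g : K} (hg : IsRegularBranch R g) (hgx : ∃ h : g / (x : K) ∈ R₁, (⟨g / (x : K), h⟩ : R₁) ∈ maximalIdeal R₁) :
    contactAt R₁ (g / (x : K)) x = 1 ∧ contactAt R₁ (x : K) (g / (x : K)) = 1 := by
  obtain ⟨hgR, hgm, hg2⟩ := hg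
  obtain ⟨hgx, hgx₁⟩ := hgx
  have hm := span_pair_eq_of_div_mem_maximalIdeal hdim hq hx hx0 hT (g := ⟨g, hgR⟩) hgm hg2 hgx₁
  have h := contactOrder_div_chart_eq_one hdim₁ hq hm hx0 hT hgx hgx₁
  rw [← contactAt_eq, ← contactAt_eq] at h
  exact h

/-- For two DISTINCT regular branches `f, g` at `R` of finite contact `n` whose strict transforms both pass through `R₁`:
`n ≥ 2` and `contactAt R₁ (f/x) (g/x) = n − 1`. [OURS · proved] -/
theorem two_le_and_contactAt_div_div (hdim : ringKrullDim R = 2) (hdim₁ : ringKrullDim R₁ = 2)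
    (hq : IsQuadraticTransform R R₁) {x : R} (hx : x ∈ maximalIdeal R) (hx0 : x ≠ 0) (hT : blowupRing R (x : K) ≤ R₁)
    {f g : K} (hf : IsRegularBranch R f) (hg : IsRegularBranch R g)
    (hfx : ∃ h : f / (x : K) ∈ R₁, (⟨f / (x : K), h⟩ : R₁) ∈ maximalIdeal R₁)
    (hgx : ∃ h : g / (x : K) ∈ R₁, (⟨g / (x : K), h⟩ : R₁) ∈ maximalIdeal R₁) {n : ℕ} (hn : contactAt R f g = n) :
    2 ≤ n ∧ contactAt R₁ (f / (x : K)) (g / (x : K)) = (n - 1 : ℕ) := by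
  obtain ⟨hfR, hfm, hf2⟩ := hf
  obtain ⟨hgR, hgm, -⟩ := hg
  obtain ⟨hfx, hfx₁⟩ := hfx
  obtain ⟨hgx, hgx₁⟩ := hgx
  have hm := span_pair_eq_of_div_mem_maximalIdeal hdim hq hx hx0 hT (g := ⟨f, hfR⟩) hfm hf2 hfx₁
  rw [show f = ((⟨f, hfR⟩ : R) : K) from rfl, show g = ((⟨g, hgR⟩ : R) : K) from rfl, contactAt_eq] at hn
  have h := two_le_and_contactOrder_div_div hdim hdim₁ hq hm hx0 hT hfx hfx₁ (g := ⟨g, hgR⟩) hgx hgx₁ hn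
  rw [← contactAt_eq] at h
  exact h

/-- **Distinctness persists**: if the branches of `B` are regular with pairwise finite contact, so are those of the transformed
configuration. [OURS · proved] -/
theorem contactAt_ne_top_transformAt (hdim : ringKrullDim R = 2) (hdim₁ : ringKrullDim R₁ = 2)
    (hq : IsQuadraticTransform R R₁) {x : R} (hx : x ∈ maximalIdeal R) (hx0 : x ≠ 0) (hT : blowupRing R (x : K) ≤ R₁)
    {B : Finset K} (hB : ∀ f ∈ B, IsRegularBranch R f) (hfin : ∀ f ∈ B, ∀ g ∈ B, f ≠ g → contactAt R f g ≠ ⊤) :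
    ∀ p ∈ transformAt R₁ ((x : R) : K) B, ∀ q ∈ transformAt R₁ ((x : R) : K) B, p ≠ q → contactAt R₁ p q ≠ ⊤ := by
  intro p hp q hq' hpq
  rcases mem_transformAt_iff.mp hp with rfl | ⟨f, hfB, rfl, hfx⟩ <;>
    rcases mem_transformAt_iff.mp hq' with rfl | ⟨g, hgB, rfl, hgx⟩
  · exact absurd rfl hpq
  · rw [(contactAt_chart_div_eq_one hdim hdim₁ hq hx hx0 hT (hB g hgB) hgx).2]; exact ENat.coe_ne_top 1
  · rw [(contactAt_chart_div_eq_one hdim hdim₁ hq hx hx0 hT (hB f hfB) hfx).1]; exact ENat.coe_ne_top 1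
  · have hfg : f ≠ g := fun e => hpq (by rw [e])
    obtain ⟨n, hn⟩ := ENat.ne_top_iff_exists.mp (hfin f hfB g hgB hfg)
    rw [(two_le_and_contactAt_div_div hdim hdim₁ hq hx hx0 hT (hB f hfB) (hB g hgB) hfx hgx hn.symm).2]
    exact ENat.coe_ne_top _

/-- The transformed configuration is `{x} ∪ (T.image (· / (x : K)))` for `T ⊆ B` the branches whose strict transform passes through
`R₁`, with `x ∉ T.image (· / (x : K))` (a regular `g` is not `x²`). [OURS · proved] -/
theorem transformAt_eq_insert_image {R₁' : Subring K} [IsLocalRing R₁'] {R' : Subring K} [IsLocalRing R'] {x : R'}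
    (hx : x ∈ maximalIdeal R') (hx0 : x ≠ 0) {B : Finset K} (hB : ∀ f ∈ B, IsRegularBranch R' f) :
    transformAt R₁' ((x : R') : K) B =
      insert ((x : R') : K) ((B.filter fun g => ∃ h : g / (x : K) ∈ R₁', (⟨g / (x : K), h⟩ : R₁') ∈ maximalIdeal R₁').image
        fun g => g / (x : K)) ∧
    ((x : R') : K) ∉ (B.filter fun g => ∃ h : g / (x : K) ∈ R₁', (⟨g / (x : K), h⟩ : R₁') ∈ maximalIdeal R₁').image fun g => g / (x : K) := by
  have hx0K : ((x : R') : K) ≠ 0 := fun e => hx0 (Subtype.ext e)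
  constructor
  · unfold transformAt
    rw [Finset.filter_image]
  · intro hmem
    obtain ⟨g, hg, hgx⟩ := Finset.mem_image.mp hmem
    have hgB := (Finset.mem_filter.mp hg).1
    obtain ⟨hgR, -, hg2⟩ := hB g hgB
    apply hg2
    have e : (⟨g, hgR⟩ : R') = x * x := Subtype.ext (by
      change g = (x : K) * (x : K)
      rw [← div_eq_iff hx0K]; exact hgx)
    rw [e, pow_two]
    exact Ideal.mul_mem_mul hx hx

end Step

end Summit.ResolutionOfSingularities.ResolutionOfSingularities.Theorems.SigmaMaxModificationsCorridor3.TameLowSnc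

end
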